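import Summits.HodgeConjecture.HodgeConjecture.Theses.HeckePrymWeil
import Summits.HodgeConjecture.HodgeConjecture.Theorems.HeckePrymWeilHodgeWeilOfWeilTransport
import Summits.HodgeConjecture.HodgeConjecture.Theorems.HeckePrymWeilHeckePrymAnchorsOfDeligneWeilFamily
import Literature.AlgebraicGeometry.HodgeTheory.WeilFamilyKAction
import Literature.AlgebraicGeometry.HodgeTheory.WeilFamilyBalanced
import Literature.AlgebraicGeometry.HodgeTheory.BlochSemiregularSpread
import Literature.AlgebraicGeometry.HodgeTheory.BlochSemiregularityTheorem
import Literature.AlgebraicGeometry.HodgeTheory.FlatFamilyCycleClass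
import Summits.HodgeConjecture.HodgeConjecture.Theorems.HeckePrymWeilSemiregularSpreadOfBlochLifts
import Literature.AlgebraicGeometry.HodgeTheory.AlgebraicityLocus
import Literature.AlgebraicGeometry.HodgeTheory.AlgebraicityLocusIUnionClosedProofs
import Literature.AlgebraicGeometry.HodgeTheory.AlgebraicClassesHodgeTypeHolds
import Literature.AlgebraicGeometry.HodgeTheory.HypersurfaceLefschetzProofs
import Literature.AlgebraicGeometry.HodgeTheory.MotivatedClassesDeformationInputs
import Literature.AlgebraicGeometry.HodgeTheory.RelativeHyperplaneClassHodgeRiemann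
import Literature.AlgebraicGeometry.Motives.VeryGeneralComplexPoint
import Literature.AlgebraicGeometry.Motives.SegreHyperplaneClass
import Literature.AlgebraicGeometry.HodgeTheory.HyperplaneClassRational
import HarnessLib.Audit

/-!
# Line `semiregular-clean-lci-anchor` — skeleton r2 for crux `HeckePrymWeil.WeilTwelvefoldsSqrtMinus7`
(item stmt-HodgeConjecture-1261, route route-HodgeConjecture-HeckePrymWeil; crux-strategist
`planner-cstrat-stmt-HodgeConjecture-1261-p1-0`, 2026-08-17; r1 by lead c14: Stub 4 closed by the tree theorem
`charlesSchnell_algebraicityLocus_iUnion_closed_holds`; r2 by lead `prover-line-stmt-HodgeConjecture-1261-c15-0`: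
the monolithic named fact `BlochSemiregularSpread 12 6` (Stub 3 of r1) is REPLACED by the two named facts it follows
from — Bloch's OBJECT-level theorem `Bloch1972_semiregularSubschemeLifts` (Stub 3a) and Fulton's specialisation of the
cycle class of a flat family `fulton1998_flatFamily_cycleClass_specialises` (Stub 3b), both SHARED with crux 1076's line
`polar-patch-broken-cycles` — plus the glue `semiregularSpread_glue` (purity, rigidity of flat sections, open image of
an étale base change); accordingly Stub 2 is restated in the INPUT SHAPE of Bloch's fact (the lci clause as "conormal
sheaf finite locally free", the codimension clauses à la Fulton, and the subscheme produced inside ANY copy `X₀ ≅ Y.X` of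
the anchor — the composition takes the fibre `𝒳_{s₀}` itself, so no transport of `IsBlochSemiregular` along an
isomorphism is needed); open stubs: 1 (route item stmt-16866 by name), 2' (hardest, research), 3a, 3b (named print facts))

Crux (FIXED, the route's typing): on every complex abelian 12-fold `A` with `φ ≫ φ = -7` every rational
`(6,6)`-class of the typed Weil plane `Eig((𝟙+φ)^*, (1+i√7)¹²) ⊔ Eig((𝟙+φ)^*, (1-i√7)¹²)` is algebraic.

IDEA.  Every dead line of this crux died at the TRANSPORT step (variational Hodge along the 36-dimensional
Weil family: `WT(7,6)`, crux-equivalent; `GluedBundleExtends`, VHC-strength; HC one rung up) for which no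
ENGINE exists.  This line replaces the transport conjecture by a transport THEOREM — Bloch's semiregularity
theorem (Bloch 1972 Thm (7.4)/(7.5) = Buchweitz–Flenner 2003 Thm 5.2 at `I = {p}`), typed in the tree on real
carriers as the named fact `HodgeTheory.BlochSemiregularSpread` — and moves ALL the open content into one
EXISTENCE statement on ONE explicit special fibre: on the tensor-type anchor `Y ~ A₁ ⊗ 𝒪_K` of Deligne's
Weil family (route item `DeligneWeilFamily`, stmt-HodgeConjecture-16866), a non-zero multiple of the Weil
class, corrected by a linear-section class, is the class line of an INTEGRAL local complete intersection
6-cycle which is BLOCH-SEMIREGULAR ("clean, charged, semiregular").  Cleanliness (the class is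
`α•w + ι^*θ`, `θ ∈ H¹²(ℙᴺ)`) is exactly what makes the class extend to a global class Hodge on EVERY fibre,
so Bloch's theorem spreads algebraicity to a Euclidean neighbourhood of the anchor; the algebraicity locus
of a global class being a countable union of Zariski-closed sets (Charles–Schnell Prop. 11.3.11, named fact
`charlesSchnell_algebraicityLocus_iUnion_closed`), Baire on the irreducible base gives EVERY fibre, in
particular the fibre `≅ X` we started from.  The existence stub is NOT implied by the Hodge conjecture
(semiregular representatives of algebraic classes are "wide open", Bloch 1972 Rem. (7.5)) — it is a
STRENGTHENING at one point that buys a theorem everywhere else; it is refutable in principle (killable).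

Stubs: `stub_deligneWeilFamily` (= route decl `DeligneWeilFamily` BY NAME, item 16866, TRUE/XL),
`stub_semiregularCleanLci` (NEW, hardest, open), `stub_blochSemiregularSpread` (named fact, TRUE in print),
`stub_algebraicityLocusClosed` (CLOSED in r1 by the tree theorem `charlesSchnell_algebraicityLocus_iUnion_closed_holds`).  Composition `WeilTwelvefoldsSqrtMinus7_of_stubs`
concludes the crux BY NAME; all glue (Deligne package with its anchor, fibre embedding, non-vanishing of the
transported class, corrected global class, Baire propagation, return along the chart) is sorry-free.
-/

noncomputable section

set_option linter.dupNamespace false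

open CategoryTheory AlgebraicGeometry Limits MonoidalCategory CartesianMonoidalCategory
open Literature.AlgebraicGeometry Literature.AlgebraicGeometry.Motives
  Literature.AlgebraicGeometry.HodgeTheory Literature.AlgebraicTopology.SingularHomology
open Summit.HodgeConjecture.HodgeConjecture.Theorems.HeckePrymWeilLine

namespace Summit.HodgeConjecture.HodgeConjecture.Cruxes.WeilTwelvefoldsSqrtMinus7.SemiregularCleanLciAnchor

/-! ### The registered stubs (r2) -/

/-- **Stub 1 — REACH = DELIGNE'S WEIL FAMILY THROUGH `X`, the route item stmt-HodgeConjecture-16866 BY NAME.**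
For `p ≡ 3 (4)` prime `≥ 7`, `k ≥ 1`, a `√-p`-abelian `2k`-fold `(X, Φ)` and a non-zero rational `(k,k)`
class `c` of its strong Weil plane: a smooth projective family `f : 𝒳 → S` of relative dimension `2k`,
closed in `ℙᴺ × S`, over a smooth irreducible quasi-projective base, a global endomorphism `g` (the `√-p`),
a chart `e : X ≅ 𝒳_{s₁}` intertwining `Φ` and `g`, abelian charts at every fibre, a GLOBAL class `W` with
`W|_{𝒳_{s₁}} = e^{-1 *} c`, and a tensor-type fibre `Y ≅ 𝒳_{s₀}` (isogeny pair with `(A₁ × A₁,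
(x, y) ↦ (-p·y, x))`, `dim A₁ = k`).  TRUE (Deligne, LNM 900, proof of Thm 4.8); Lean-XL; carried by its
own item — used here only at `(p, k) = (7, 6)`.
[cite: Deligne1982HodgeCycles, proof of Thm. 4.8 (pp. 47–52), clauses (b), (c)]
[cite: vanGeemen1994HodgeAV, §5.3–5.11] -/
theorem stub_deligneWeilFamily :
    Summit.HodgeConjecture.HodgeConjecture.Theses.HeckePrymWeil.DeligneWeilFamily := by
  sorry

/-- **Stub 2 (NEW, hardest; open) — A CLEAN, CHARGED, BLOCH-SEMIREGULAR INTEGRAL LCI 6-CYCLE ON THE TENSOR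
ANCHOR.**  Let `(Y, Ψ)` be a complex abelian 12-fold with `Ψ ≫ Ψ = -7` of TENSOR TYPE — it admits an
isogeny pair `f₁ : Y → A₁ × A₁`, `g₁ : A₁ × A₁ → Y`, `f₁ ≫ g₁ = m`, `f₁` flat, with `g₁` intertwining
`Ψ` and `(x, y) ↦ (-7y, x)`, for SOME abelian 6-fold `A₁` (the anchor fibre of Deligne's family) — let
`e : Y ↪ ℙᴺ` be a projective embedding whose hyperplane class `h = e^*a` (`a ∈ H²(ℙᴺ)` rational,
non-zero) is `K`-SYMMETRIC, `Ψ^* h = 7 h` — i.e. `±` a `K`-compatible polarization, the one that survives on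
the generic Weil fibre (supplied in the composition by the Segre–Veronese symmetrisation `7h₀ + Ψ^*h₀` of
the family's hyperplane class) — and `x₀` a NON-ZERO rational `(6,6)` class of the strong Weil plane
`weilClassesOf Y Ψ 6 7`.  Then there are an INTEGRAL closed subscheme `i : Z ↪ Y`, a local complete
intersection of codimension 6 (regular immersion; every point of `Z` of codimension `≥ 6` in `Y`), which is
SEMIREGULAR in the sense of Bloch (`IsBlochSemiregular i 12 6`: Bloch's `π : H¹(Z, 𝒩) → H⁷(Y, Ω⁵)`
injective), a rational ambient class `θ ∈ H¹²(ℙᴺ(ℂ); ℂ)` and `α ∈ ℚ`, `α ≠ 0`, such that the CLEAN CHARGED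
class `α • x₀ + e^*θ` is supported on `Z` (i.e. it spans the class line `ℂ·cl(Z)`: `cl(Z) ∈ ℚ^× x₀ + ℚ h⁶`).
WHY IT MIGHT HOLD: `x₀` IS algebraic on `Y` (Künneth components of `Δ_{A₁}` across the isogeny —
`owf_anchorAlgebraic`, landed), so this is Bloch's problem (7.5) "semiregular representatives of algebraic
classes" for ONE class on ONE variety; the Hodge locus of `α x₀ + h⁶` in the Kuranishi space of `Y` is the
smooth 36-dimensional Weil germ (a `U(6,6)`-orbit in the period domain), so Bloch's necessary condition
(smoothness of the Hodge locus = image of the unobstructed embedded deformations) holds — unlike the Fermat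
anchors of the refuted crux `SemiregularSeedsOnAnchors` (13941), where a `T²` obstruction killed the seed.
Candidates: zero loci of regular sections of ample rank-6 bundles `E` with `c₆(E)` clean (Lefschetz for
`k < 6` automatic, matching the kernel-rigidity constraint R5 of `IdeatorThreeNotes`), degeneracy loci,
Fourier–Mukai images.  WHY IT MIGHT FAIL: cleanliness forces `cl(Z)` to straddle the `Sp₁₂`-isotypic
components of `H¹²(A₁ × A₁)` (no abelian subvariety, graph, or complete intersection of the divisors
`θ₁, θ₂, P` is clean), and semiregularity in codimension 6 on an abelian 12-fold has never been verified
for any charged cycle; lead c15's analysis (`Lines/semiregular-clean-lci-anchor-stub2-c15.md`): complete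
intersections are never clean charged effective (Fermat identity), and zero / degeneracy loci of sufficiently
twisted DIRECT-SUM bundles are never semiregular (`H¹(N_Z) ≅ H²(End E)`, every summand must be first-order
unobstructed along the 15 non-tensor Weil directions) — the residual content is a Weil-deformable charged bundle
on the anchor.  NOT implied by the crux; implies it only through Stubs 3a/3b (theorems in print).
r2 SHAPE: the conclusion is stated inside ANY copy `X₀` of the underlying variety (`e' : Y.X ≅ X₀`; the
composition takes the fibre `𝒳_{s₀}` of Deligne's family and `e' = e₀`), with the lci clause as "conormal sheaf
finite locally free" and the codimension clauses in Fulton's form (all points of codimension `≥ 6`, one of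
codimension exactly `6`) — exactly the input of `Bloch1972_semiregularSubschemeLifts` /
`fulton1998_flatFamily_cycleClass_specialises`; for `Y` smooth, "conormal sheaf locally free of rank 6" ⟺
"regular immersion of codimension 6" (Vasconcelos), so the content is that of r1's Stub 2.
[informal size L/XL; open — Bloch 1972 Remark (7.5)]
[cite: Bloch1972Semiregularity, §1, Thm. (7.3), Remark (7.5)] [cite: BuchweitzFlenner2003, (8.1), Prop. 8.2]
[cite: Deligne1982HodgeCycles, Lemma 4.5 and proof of Thm. 4.8] [cite: Matsumura1987, Thm. 19.9] -/
theorem stub_semiregularCleanLci :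
    ∀ (Y : AbelianVariety ℂ) (Ψ : Y ⟶ Y), Y.dim = 2 * 6 → Ψ ≫ Ψ = -((7 : ℤ) • 𝟙 Y) →
      (∃ (A₁ : AbelianVariety ℂ) (f₁ : Y ⟶ A₁.prod A₁) (g₁ : A₁.prod A₁ ⟶ Y) (m : ℕ),
          A₁.dim = 6 ∧ 0 < m ∧ f₁ ≫ g₁ = m • 𝟙 Y ∧ Flat f₁.hom.hom.hom.left ∧
          g₁ ≫ Ψ = AbelianVariety.prodLift (AbelianVariety.snd A₁ A₁ ≫ (-((7 : ℤ) • 𝟙 A₁)))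
            (AbelianVariety.fst A₁ A₁) ≫ g₁) →
      ∀ (e : ProjectiveEmbedding Y.X) (a : complexBetti (projectiveSpace e.n ℂ) 2),
        IsRationalClass a → a ≠ 0 →
        -- the hyperplane class `h = e^* a` is `K`-SYMMETRIC: `Ψ^* h = 7 h` (a `K`-compatible polarization)
        complexBetti.map Ψ.hom.hom.hom 2 (complexBetti.map e.ι 2 a) = (7 : ℂ) • complexBetti.map e.ι 2 a →
      ∀ (x₀ : complexBetti Y.X (2 * 6)),
        x₀ ∈ weilClassesOf Y Ψ 6 7 → x₀ ≠ 0 → IsRationalClass x₀ →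
        IsOfHodgeType (2 * 6) Y.X (2 * 6) 6 6 x₀ →
      -- read in ANY copy `X₀` of the anchor (the composition takes the fibre `𝒳_{s₀}` of Deligne's family)
      ∀ (X₀ : SchemeOver ℂ) (e' : Y.X ≅ X₀),
        ∃ (Z : Scheme.{0}) (i : Z ⟶ X₀.left) (θ : complexBetti (projectiveSpace e.n ℂ) (2 * 6)) (α : ℚ),
          IsClosedImmersion i ∧ IsFiniteLocallyFree (Deformation.conormalSheaf i) ∧
          AlgebraicGeometry.IsIntegral Z ∧
          (∀ z : Z, ((6 : ℕ) : ℕ∞) ≤ Order.coheight (i.base z)) ∧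
          (∃ z : Z, Order.coheight (i.base z) = ((6 : ℕ) : ℕ∞)) ∧
          IsBlochSemiregular i (2 * 6) 6 ∧ IsRationalClass θ ∧ α ≠ 0 ∧
          complexBetti.map e'.inv (2 * 6) ((α : ℂ) • x₀ + complexBetti.map e.ι (2 * 6) θ) ∈
            classesSupportedOn X₀ (Set.range i.base) (2 * 6) := by
  sorry

/-- **Stub 3a — BLOCH'S SEMIREGULARITY THEOREM, object level, relative form** (named fact
`HodgeTheory.Bloch1972_semiregularSubschemeLifts`: Bloch 1972 Thm (7.1) with the proof of Thm (7.4), étale-locally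
on the base by Artin approximation): a Bloch-semiregular local complete intersection on a fibre of a smooth
projective family, whose component classes stay of type `(p,p)` along the family, lifts to a FLAT family of
subschemes over an étale neighbourhood of the marked point.  TRUE in print; Lean-XL (Hilbert schemes, Artin
approximation); SHARED with crux 1076's line `polar-patch-broken-cycles` (its stub S1a) — any discharge serves
both.  THE ENGINE of the line.
[cite: Bloch1972Semiregularity, Thm. (7.1), proof of Thm. (7.4), Cor. (6.10)] [cite: Artin1969, Cor. (2.2)]
[cite: BuchweitzFlenner2003, Thm. 5.2, Prop. 8.2] -/
theorem stub_blochLifts : Bloch1972_semiregularSubschemeLifts := by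
  sorry

/-- **Stub 3b — SPECIALISATION OF THE CYCLE CLASS OF A FLAT FAMILY** (named fact
`HodgeTheory.fulton1998_flatFamily_cycleClass_specialises`: Fulton 1998 Prop. 10.1 (a), Cor. 10.1, Cor. 19.2 (b),
Lemma 19.1.1): the fibre classes of a flat family of codimension-`p` subschemes of a smooth projective family
are the restrictions of ONE global class, algebraic on every fibre, with a non-zero coefficient on a component
of the expected codimension.  TRUE in print; Lean-L (no cycle class map for families on real carriers yet);
SHARED with crux 1076's line (its stub S2a).
[cite: Fulton1998, §10.1 Prop. 10.1 (a), Cor. 10.1; §19.1 Lemma 19.1.1; §19.2 Cor. 19.2 (b)]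
[cite: VoisinHodgeII2003, §9.2] -/
theorem stub_fultonSpecialises : fulton1998_flatFamily_cycleClass_specialises := by
  sorry

/-! ### Glue (r2, LANDED p141513): `Theorems.HeckePrymWeilLine.semiregularSpread_of_blochLifts_of_fulton` — the spread
step from Stubs 3a + 3b (Bloch lifts the semiregular lci to a flat family over an étale neighbourhood, Fulton gives its global
class, purity on the central fibre, rigidity of flat sections, open image of the smooth base change with liftable complex
points); imported, used in `crux_of_stubs` below. -/


/-- **Stub 4 — THE ALGEBRAICITY LOCUS OF A GLOBAL CLASS IS A COUNTABLE UNION OF ZARISKI-CLOSED SUBSETS**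
(named fact `HodgeTheory.charlesSchnell_algebraicityLocus_iUnion_closed`: Charles–Schnell Prop. 11.3.11,
Voisin *Hodge II* §3.3.1 — countably many components of the relative Hilbert scheme, each proper over the
base, cycle classes flat).  CLOSED (r1): it is a THEOREM of the tree,
`charlesSchnell_algebraicityLocus_iUnion_closed_holds` (`AlgebraicityLocusIUnionClosedProofs.lean`: hyperplane
witness families, embedded log resolution + Ehresmann relative to an snc boundary, Mumford's curve lemma).
[cite: CharlesSchnell2014Notes, Prop. 11.3.11 (proof)] [cite: VoisinHodgeII2003, §3.3.1 and §7.3.2] -/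
theorem stub_algebraicityLocusClosed : charlesSchnell_algebraicityLocus_iUnion_closed :=
  charlesSchnell_algebraicityLocus_iUnion_closed_holds

/-! ### Glue 1 (sorry-free): Baire propagation — algebraic on a non-empty open set ⟹ algebraic everywhere -/

/-- **Open-to-everywhere propagation of algebraicity** over an irreducible base: granted Stub 4, if the
fibre restrictions of a global class `A` are algebraic on a non-empty open subset `U ⊆ S(ℂ)` (complex
topology) then they are algebraic at EVERY complex point — otherwise every closed set `W_j` of the
structure theorem is proper, and a point of `U` outside all of them (Baire: very general points are dense,
`ComplexPoints.exists_mem_forall_pt_not_mem`) contradicts `U ⊆ ⋃ W_j(ℂ)`.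
[cite: VoisinHodgeII2003, §3.3.1] [cite: CharlesSchnell2014Notes, Prop. 11.3.11] -/
theorem forall_mem_algebraicClasses_of_isOpen (hCS : charlesSchnell_algebraicityLocus_iUnion_closed)
    {𝒳 S : SchemeOver ℂ} (f : 𝒳 ⟶ S) {n p : ℕ} (hfam : IsSmoothProjectiveFamily f n)
    (h𝒳 : IsQuasiProjectiveOver 𝒳) (hS : IsQuasiProjectiveOver S) (hsm : AlgebraicGeometry.Smooth S.hom)
    (hirr : IrreducibleSpace S.left) (A : complexBetti 𝒳 (2 * p)) {U : Set (ComplexPoints S)}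
    (hUo : IsOpen U) (hUne : U.Nonempty)
    (hU : ∀ t ∈ U, complexBetti.map (fiberι f t) (2 * p) A ∈ algebraicClasses (fiberOver f t) p) :
    ∀ t : ComplexPoints S, complexBetti.map (fiberι f t) (2 * p) A ∈ algebraicClasses (fiberOver f t) p := by
  obtain ⟨Wj, hWc, hloc⟩ := hCS f n p h𝒳 hS hsm hfam A
  haveI := hirr
  haveI : IsSeparated S.hom := hS.isSeparated
  haveI : LocallyOfFiniteType S.hom := hS.locallyOfFiniteType
  by_contra! hnot
  obtain ⟨t₀, ht₀⟩ := hnot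
  have hne : ∀ j, Wj j ≠ Set.univ := by
    intro j hj
    apply ht₀
    have hmem : t₀ ∈ ⋃ j, {t : ComplexPoints S | t.pt ∈ Wj j} :=
      Set.mem_iUnion.2 ⟨j, by simp [hj]⟩
    rw [← hloc] at hmem
    exact hmem
  obtain ⟨P, hPU, hP⟩ := ComplexPoints.exists_mem_forall_pt_not_mem (X := S) hWc hne hUo hUne
  have hPmem : P ∈ {t : ComplexPoints S |
      complexBetti.map (fiberι f t) (2 * p) A ∈ algebraicClasses (fiberOver f t) p} := hU P hPU
  rw [hloc] at hPmem
  obtain ⟨j, hj⟩ := Set.mem_iUnion.1 hPmem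
  exact hP j hj

/-! ### Glue 2 (sorry-free): Deligne's family package WITH ITS ANCHOR, from Stub 1 -/

/-- Stub 1 (the route item, global-class rendering) gives the Literature package
`deligne1982_weilFamily_globalAction` (charts-only rendering, balanced clause derived in the tree):
`kAction_of_deligneWeilFamily` then `deligne1982_weilFamily_globalAction_of_kAction`.
[cite: Deligne1982HodgeCycles, proof of Thm. 4.8 with Prop. 4.4] -/
theorem globalAction_of_stub_deligneWeilFamily (h₁ : type_of% stub_deligneWeilFamily) :
    deligne1982_weilFamily_globalAction :=
  deligne1982_weilFamily_globalAction_of_kAction (kAction_of_deligneWeilFamily h₁)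

/-- **Deligne's Weil family through `X` with its global Weil class AND its tensor anchor exposed.**  The
tree's `weilFamily_globalWeilClass_of_globalAction` (lead c5 of this crux) re-proved with a longer
conclusion: besides the family `f : 𝒳 → S` (smooth projective of relative dimension `2k`, closed in
`ℙᴺ × S`, over a smooth irreducible quasi-projective base), the chart `e : X ≅ 𝒳_{s₁}` and the global class
`W` (fibrewise rational of type `(k,k)`, `W|_{s₁} = e^{-1 *} c`), it returns the TENSOR FIBRE
`e₀ : Y ≅ 𝒳_{s₀}` with its `√-p`-structure `Ψ`, its isogeny pair with `A₁ × A₁`, and the facts that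
`x₀ := e₀^*(W|_{s₀})` lies in the strong Weil plane of `(Y, Ψ)` and is NON-ZERO (parallel transport of
the non-zero `e^{-1 *} c`), together with the global `√-p` endomorphism `g` (over `S`, intertwined with
`Ψ` by `e₀`).  Proof: verbatim the tree's (section
globalised by the W-engine, rationality along the section, transport of the Weil eigen-lines under the
global `√-p` read in the charts), plus `transportFun_map_fiberι` for the non-vanishing.
[cite: Deligne1982HodgeCycles, proof of Thm. 4.8 (pp. 47–52) with Prop. 4.4, Lemma 4.5, Remark 4.10]
[cite: VoisinHodgeII2003, §3.1.2] -/
theorem weilFamily_anchorPackage_of_globalAction (hGA : deligne1982_weilFamily_globalAction)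
    {p : ℕ} (hp : p.Prime) (hp4 : p % 4 = 3) (hp7 : 7 ≤ p) {k : ℕ} (hk : 1 ≤ k)
    (X : AbelianVariety ℂ) (Φ : X ⟶ X) (hX : X.dim = 2 * k) (hΦ : Φ ≫ Φ = -((p : ℤ) • 𝟙 X))
    (c : complexBetti X.X (2 * k)) (hc : c ∈ weilClassesOf X Φ k p) (hc0 : c ≠ 0)
    (hrat : IsRationalClass c) (hH : IsOfHodgeType (2 * k) X.X (2 * k) k k c) :
    ∃ (𝒳 S : SchemeOver ℂ) (f : 𝒳 ⟶ S) (s₁ s₀ : ComplexPoints S) (e : X.X ≅ fiberOver f s₁)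
      (W : complexBetti 𝒳 (2 * k)) (Y : AbelianVariety ℂ) (Ψ : Y ⟶ Y) (e₀ : Y.X ≅ fiberOver f s₀)
      (g : 𝒳 ⟶ 𝒳),
      IsSmoothProjectiveFamily f (2 * k) ∧
      (∃ (N : ℕ) (ι : 𝒳 ⟶ projectiveSpace N ℂ ⊗ S),
          IsClosedImmersion ι.left ∧ ι ≫ snd (projectiveSpace N ℂ) S = f) ∧
      IrreducibleSpace S.left ∧ AlgebraicGeometry.Smooth S.hom ∧ IsQuasiProjectiveOver S ∧
      g ≫ f = f ∧ (e₀.hom ≫ fiberι f s₀) ≫ g = Ψ.hom.hom.hom ≫ (e₀.hom ≫ fiberι f s₀) ∧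
      (∀ s : ComplexPoints S, IsRationalClass (complexBetti.map (fiberι f s) (2 * k) W) ∧
        IsOfHodgeType (2 * k) (fiberOver f s) (2 * k) k k (complexBetti.map (fiberι f s) (2 * k) W)) ∧
      complexBetti.map (fiberι f s₁) (2 * k) W = complexBetti.map e.inv (2 * k) c ∧
      Y.dim = 2 * k ∧ Ψ ≫ Ψ = -((p : ℤ) • 𝟙 Y) ∧
      (∃ (A₁ : AbelianVariety ℂ) (f₁ : Y ⟶ A₁.prod A₁) (g₁ : A₁.prod A₁ ⟶ Y) (m : ℕ),
          A₁.dim = k ∧ 0 < m ∧ f₁ ≫ g₁ = m • 𝟙 Y ∧ Flat f₁.hom.hom.hom.left ∧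
          g₁ ≫ Ψ = AbelianVariety.prodLift (AbelianVariety.snd A₁ A₁ ≫ (-((p : ℤ) • 𝟙 A₁)))
            (AbelianVariety.fst A₁ A₁) ≫ g₁) ∧
      complexBetti.map e₀.hom (2 * k) (complexBetti.map (fiberι f s₀) (2 * k) W) ∈ weilClassesOf Y Ψ k p ∧
      complexBetti.map e₀.hom (2 * k) (complexBetti.map (fiberι f s₀) (2 * k) W) ≠ 0 := by
  obtain ⟨𝒳, S, f, g, s₁, s₀, e, σ, hfam, hemb, hirr, hsm, hSqp, hg, hfib, he, hσ, hpt, hσ₁, Y, Ψ,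
    e₀, ⟨A₁, f₁, g₁, m, hA₁, hY, hΨ, hm, hfg, hf, hg₁⟩, he₀⟩ := hGA p hp hp4 hp7 k hk X Φ hX hΦ c hc hc0 hrat hH
  have hp0 : 0 < p := hp.pos
  -- the base: `S(ℂ)` is a path-connected manifold and `R^{2k} f_* ℂ` is a local system on it
  haveI := hsm
  haveI := hirr
  haveI : LocallyOfFiniteType S.hom := hSqp.locallyOfFiniteType
  haveI : ConnectedSpace (ComplexPoints S) :=
    (Motives.ComplexPoints.connectedSpace_iff_holds S).2 inferInstance
  obtain ⟨d, hd⟩ := exists_smoothOfRelativeDimension_of_connectedSpace_complexPoints S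
  haveI := hd
  haveI := pathConnectedSpace_complexPoints_of_smoothOfRelativeDimension S d
  have hU := isCohomologicallyLocallyTrivialOn_univ_of_isSmoothProjectiveFamily f d hfam hSqp
  -- the fibre maps of `g`
  have hgf' := fun t ↦ exists_fiberHom_comp_fiberι f g hg t
  choose gf hgf using hgf'
  -- the cohomological Weil plane of the fibre over `t`
  let WP : ∀ t : ComplexPoints S, Submodule ℂ (complexBetti (fiberOver f t) (2 * k)) :=
    fun t ↦
      Submodule.span ℂ
        {x | ∃ w : Fin (2 * k) → complexBetti (fiberOver f t) 1,
          (∀ i, w i ∈ Module.End.eigenspace (complexBetti.map (gf t) 1).hom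
            (Complex.I * (Real.sqrt p : ℂ))) ∧
          cupPowOne ℂ (ComplexPoints (fiberOver f t)) (2 * k) w = x} ⊔
      Submodule.span ℂ
        {x | ∃ w : Fin (2 * k) → complexBetti (fiberOver f t) 1,
          (∀ i, w i ∈ Module.End.eigenspace (complexBetti.map (gf t) 1).hom
            (-(Complex.I * (Real.sqrt p : ℂ)))) ∧
          cupPowOne ℂ (ComplexPoints (fiberOver f t)) (2 * k) w = x}
  -- at `s₁`: `e^{-1 *} c` lies in the Weil plane of `(𝒳_{s₁}, g_{s₁})`
  have hΦ' : Φ ≫ Φ = -(p • 𝟙 X) := by rw [hΦ, natCast_zsmul]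
  have he' : e.hom ≫ gf s₁ = Φ.hom.hom.hom ≫ e.hom :=
    hom_comp_fiberHom_eq_of_comp_fiberι f g (hgf s₁) e Φ.hom.hom.hom he
  have h₁ : complexBetti.map e.inv (2 * k) c ∈ WP s₁ :=
    map_inv_mem_eigenLines_of_mem_weilClassesOf e (gf s₁) hp0 hX hΦ' he' hc
  -- transport from `s₁`: every value of `σ` lies in the Weil plane of its fibre
  have key : ∀ (s t : ComplexPoints S) (hst : (σ s).pt = t), (σ s).clsAt hst ∈ WP t := by
    intro s t hst
    obtain rfl : s = t := (hpt s).symm.trans hst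
    let γ : Path (⟨s₁, Set.mem_univ s₁⟩ : (Set.univ : Set (ComplexPoints S))) ⟨s, Set.mem_univ s⟩ :=
      (PathConnectedSpace.somePath s₁ s).map (continuous_id.subtype_mk _)
    have htr := transportFun_clsAt_of_continuous f (2 * k) hU hσ hpt γ
    have h0 : (σ s₁).clsAt (hpt s₁) = complexBetti.map e.inv (2 * k) c := by
      rw [FiberClass.clsAt_eq_iff]; exact hσ₁
    change transportFun f (2 * k) hU ⟦γ⟧ ((σ s₁).clsAt (hpt s₁)) = (σ s).clsAt (hpt s) at htr
    rw [← htr, h0]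
    exact transportFun_mem_eigenLines f hU g hg gf hgf ⟦γ⟧ _ _ (2 * k) h₁
  -- the global class of the section (W-engine, discharged in the tree)
  obtain ⟨W, hWσ⟩ := stub_globalClassOfSection_of_leray deligne1968_invariantClass_fromTotalSpace_holds
    f (2 * k) (2 * k) hfam hemb hsm hSqp hirr σ hσ hpt
  have hWs : ∀ s : ComplexPoints S, complexBetti.map (fiberι f s) (2 * k) W = (σ s).clsAt (hpt s) := by
    intro s
    symm
    rw [FiberClass.clsAt_eq_iff]
    exact hWσ s
  -- rationality along the section
  have hrat₁ : IsRationalClass (σ s₁).cls := by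
    rw [hσ₁]; exact hrat.map _
  have hratσ : ∀ s, IsRationalClass (σ s).cls :=
    stub_rationalAlongSection f (2 * k) (2 * k) hfam hsm hSqp hirr σ hσ hpt s₁ hrat₁
  -- the charts: `W|_{𝒳_s}` read in `A'_s` lies in the strong Weil plane of `(A'_s, φ'_s)`
  have hchart : ∀ s : ComplexPoints S, ∃ (A' : AbelianVariety ℂ) (φ' : A' ⟶ A') (e' : A'.X ≅ fiberOver f s),
      A'.dim = 2 * k ∧ φ' ≫ φ' = -((p : ℤ) • 𝟙 A') ∧
      complexBetti.map e'.hom (2 * k) (complexBetti.map (fiberι f s) (2 * k) W) ∈ weilClassesOf A' φ' k p ∧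
      ∀ w ∈ weilClassesOf A' φ' k p, IsOfHodgeType (2 * k) A'.X (2 * k) k k w := by
    intro s
    obtain ⟨A', φ', e', hA', hφ', he'c, hbal⟩ := hfib s
    have he'' : e'.hom ≫ gf s = φ'.hom.hom.hom ≫ e'.hom :=
      hom_comp_fiberHom_eq_of_comp_fiberι f g (hgf _) e' φ'.hom.hom.hom he'c
    refine ⟨A', φ', e', hA', hφ', ?_, hbal⟩
    rw [hWs s]
    exact map_mem_weilClassesOf_of_mem_eigenLines e' (gf _) he'' (key s s (hpt s))
  -- the fibre restrictions of `W` are rational of type `(k,k)`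
  have hfibre : ∀ s : ComplexPoints S, IsRationalClass (complexBetti.map (fiberι f s) (2 * k) W) ∧
      IsOfHodgeType (2 * k) (fiberOver f s) (2 * k) k k (complexBetti.map (fiberι f s) (2 * k) W) := by
    intro s
    refine ⟨?_, ?_⟩
    · rw [hWs s]
      exact (ras_isRationalClass_clsAt_iff (σ s) (hpt s)).2 (hratσ s)
    · obtain ⟨A', φ', e', hA', hφ', hmem, hbal⟩ := hchart s
      have htyp := (hbal _ hmem).map_of_iso e'.symm
      have hid : singularCohomology.map ℂ ℂ (Motives.AlgPoints.mapContinuous (L := ℂ) e'.symm.hom) (2 * k)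
          (complexBetti.map e'.hom (2 * k) (complexBetti.map (fiberι f s) (2 * k) W)) =
            complexBetti.map (fiberι f s) (2 * k) W := by
        change complexBetti.map e'.inv (2 * k) (complexBetti.map e'.hom (2 * k) _) = _
        rw [← ModuleCat.comp_apply, ← complexBetti.map_comp, e'.inv_hom_id, complexBetti.map_id]
        rfl
      rw [hid] at htyp
      exact htyp
  -- at `s₀`: the transported class lies in the strong Weil plane of the tensor fibre `(Y, Ψ)` …
  have he₀' : e₀.hom ≫ gf s₀ = Ψ.hom.hom.hom ≫ e₀.hom :=
    hom_comp_fiberHom_eq_of_comp_fiberι f g (hgf s₀) e₀ Ψ.hom.hom.hom he₀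
  have hx : complexBetti.map e₀.hom (2 * k) (complexBetti.map (fiberι f s₀) (2 * k) W) ∈
      weilClassesOf Y Ψ k p := by
    rw [hWs s₀]
    exact map_mem_weilClassesOf_of_mem_eigenLines e₀ (gf s₀) he₀' (key s₀ s₀ (hpt s₀))
  -- … and is non-zero: `W|_{s₁} = e^{-1 *} c ≠ 0` is the parallel transport of `W|_{s₀}`
  have hW₁ : complexBetti.map (fiberι f s₁) (2 * k) W = complexBetti.map e.inv (2 * k) c := by
    rw [hWs s₁, FiberClass.clsAt_eq_iff]
    exact hσ₁
  have hW₀ne : complexBetti.map (fiberι f s₀) (2 * k) W ≠ 0 := by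
    intro h0
    let γ : Path (⟨s₀, Set.mem_univ s₀⟩ : (Set.univ : Set (ComplexPoints S))) ⟨s₁, Set.mem_univ s₁⟩ :=
      (PathConnectedSpace.somePath s₀ s₁).map (continuous_id.subtype_mk _)
    have htr := transportFun_map_fiberι f (2 * k) hU ⟦γ⟧ W
    change transportFun f (2 * k) hU ⟦γ⟧ (complexBetti.map (fiberι f s₀) (2 * k) W) =
      complexBetti.map (fiberι f s₁) (2 * k) W at htr
    rw [h0] at htr
    have hz : transportFun f (2 * k) hU ⟦γ⟧ (0 : complexBetti (fiberOver f s₀) (2 * k)) = 0 := by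
      have := transportFun_smul f (2 * k) hU ⟦γ⟧ (0 : ℂ) (0 : complexBetti (fiberOver f s₀) (2 * k))
      simpa using this
    rw [hz, hW₁] at htr
    apply hc0
    have : complexBetti.map e.hom (2 * k) (complexBetti.map e.inv (2 * k) c) = c := by
      rw [← CategoryTheory.comp_apply, ← complexBetti.map_comp, Iso.hom_inv_id, complexBetti.map_id,
        CategoryTheory.id_apply]
    rw [← this, ← htr, map_zero]
  have hx0 : complexBetti.map e₀.hom (2 * k) (complexBetti.map (fiberι f s₀) (2 * k) W) ≠ 0 := by
    intro h0
    apply hW₀ne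
    have : complexBetti.map e₀.inv (2 * k)
        (complexBetti.map e₀.hom (2 * k) (complexBetti.map (fiberι f s₀) (2 * k) W)) =
          complexBetti.map (fiberι f s₀) (2 * k) W := by
      rw [← CategoryTheory.comp_apply, ← complexBetti.map_comp, Iso.inv_hom_id, complexBetti.map_id,
        CategoryTheory.id_apply]
    rw [← this, h0, map_zero]
  exact ⟨𝒳, S, f, s₁, s₀, e, W, Y, Ψ, e₀, g, hfam, hemb, hirr, hsm, hSqp, hg, he₀, hfibre, hW₁, hY, hΨ,
    ⟨A₁, f₁, g₁, m, hA₁, hm, hfg, hf, hg₁⟩, hx, hx0⟩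

/-! ### The composition (concludes the crux BY NAME; sorry-free glue) -/

/-- **`WeilTwelvefoldsSqrtMinus7` from the four stubs as hypotheses.**  Given `(A, φ)` and a rational
`(6,6)` class `c` of the typed Weil plane: `c = 0` is algebraic; otherwise upgrade the typing
(`stub_upgrade`, landed), take Deligne's family through `A` with its anchor (Glue 2), embed the fibres in
one `ℙᵐ` (`exists_forall_isClosedImmersion_fiberι_comp`) and `K`-SYMMETRISE the embedding
(`ε_K := Segre ∘ (s₆ ∘ ε, ε ∘ g)`, hyperplane class `7·ε^*g + g^*ε^*g`, so that on the anchor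
`Ψ^* h = 7 h`: Segre additivity `exists_segreHyperplaneClasses`, `s₆^* g = 7 g`, `(Ψ ≫ Ψ)^* = 49` on `H²`),
let Stub 2 produce the semiregular integral lci `Z ⊂ 𝒳_{s₀}` (the copy `X₀ := 𝒳_{s₀}`, `e' := e₀`)
carrying `e₀^{-1 *}(α • x₀ + ι^*θ)`; the corrected global class `W' := α • W + ε_K^*θ` is fibrewise rational of
type `(6,6)` (`ε^*θ` is a linear-section class: algebraic, `map_projectiveSpace_mem_algebraicClasses`,
hence Hodge) and restricts on `𝒳_{s₀}` to the class carried by `Z`, so the glue of Stubs 3a + 3b (Bloch lifts,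
Fulton specialises, purity, rigidity, open image) makes `W'` algebraic on an open neighbourhood of `s₀`, Glue 1
(Stub 4 + Baire) on all of `S(ℂ)`; at `s₁` subtract the algebraic `ε^*θ|_{s₁}`, divide by `α`, and return
along `e : A ≅ 𝒳_{s₁}`.
[cite: Bloch1972Semiregularity, Thm. (7.1), Thm. (7.4), Remark (7.5)] [cite: Deligne1982HodgeCycles, proof of Thm. 4.8]
[cite: Fulton1998, Cor. 10.1 and Lemma 19.1.1] [cite: CharlesSchnell2014Notes, Prop. 11.3.11] -/
theorem crux_of_stubs (h₁ : type_of% stub_deligneWeilFamily) (h₂ : type_of% stub_semiregularCleanLci)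
    (h₃a : type_of% stub_blochLifts) (h₃b : type_of% stub_fultonSpecialises)
    (h₄ : type_of% stub_algebraicityLocusClosed) :
    -- the crux `HeckePrymWeil.WeilTwelvefoldsSqrtMinus7`, UNFOLDED (so that exactly one theorem of this file,
    -- `WeilTwelvefoldsSqrtMinus7_of_stubs`, has the route decl as its literal type for the skeleton audit)
    ∀ (A : AbelianVariety ℂ) (φ : A ⟶ A), A.dim = 12 → φ ≫ φ = -((7 : ℤ) • 𝟙 A) →
      ∀ c : complexBetti A.X 12, IsRationalClass c → IsOfHodgeType 12 A.X 12 6 6 c →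
        c ∈ Module.End.eigenspace (complexBetti.map (𝟙 A + φ).hom.hom.hom 12).hom
              ((1 + Complex.I * (Real.sqrt (7 : ℝ) : ℂ)) ^ 12) ⊔
            Module.End.eigenspace (complexBetti.map (𝟙 A + φ).hom.hom.hom 12).hom
              ((1 - Complex.I * (Real.sqrt (7 : ℝ) : ℂ)) ^ 12) →
        c ∈ algebraicClasses A.X 6 := by
  intro A φ hA hφ c hrat hH hW
  -- the zero class is algebraic
  by_cases hc0 : c = 0
  · rw [hc0]
    exact Submodule.zero_mem _
  have hA' : A.dim = 2 * 6 := by simpa using hA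
  have hφ' : φ ≫ φ = -(((7 : ℕ) : ℤ) • 𝟙 A) := by exact_mod_cast hφ
  have hW' : c ∈ Module.End.eigenspace (complexBetti.map (𝟙 A + φ).hom.hom.hom (2 * 6)).hom
        ((1 + Complex.I * (Real.sqrt ((7 : ℕ) : ℝ) : ℂ)) ^ (2 * 6)) ⊔
      Module.End.eigenspace (complexBetti.map (𝟙 A + φ).hom.hom.hom (2 * 6)).hom
        ((1 - Complex.I * (Real.sqrt ((7 : ℕ) : ℝ) : ℂ)) ^ (2 * 6)) := by
    exact_mod_cast hW
  have hH' : IsOfHodgeType (2 * 6) A.X (2 * 6) 6 6 c := hH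
  -- typing upgrade: `c` lies in the strong Weil plane of `(A, φ)`
  have hcW : c ∈ weilClassesOf A φ 6 7 :=
    stub_upgrade 7 (by norm_num) (by norm_num) le_rfl 6 A φ hA' hφ' hW'
  -- Deligne's family THROUGH `A`, with its tensor anchor
  obtain ⟨𝒳, S, f, s₁, s₀, e, W, Y, Ψ, e₀, g, hfam, hemb, hirr, hsm, hSqp, hg, he₀g, hfibre, hW₁, hY, hΨ,
    htensor, hx₀, hx₀ne⟩ :=
    weilFamily_anchorPackage_of_globalAction (globalAction_of_stub_deligneWeilFamily h₁)
      (p := 7) (by norm_num) (by norm_num) le_rfl (k := 6) (by norm_num) A φ hA' hφ' c hcW hc0 hrat hH'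
  haveI := hirr
  haveI := hsm
  -- quasi-projectivity of the total space
  have h𝒳qp : IsQuasiProjectiveOver 𝒳 := by
    obtain ⟨N, ι, hι, -⟩ := hemb
    haveI := hι
    exact IsQuasiProjectiveOver.of_isClosedImmersion_projectiveSpace_tensor ι hSqp
  -- one projective space for all fibres …
  obtain ⟨mN, ε, hε⟩ := exists_forall_isClosedImmersion_fiberι_comp f hfam hemb hSqp
  have hmN : 1 ≤ mN := by
    haveI := hε s₀
    exact le_trans (by norm_num) (le_of_isClosedImmersion_projectiveSpace (hfam.isSmoothProjective s₀) (fiberι f s₀ ≫ ε))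
  -- … and its `K`-SYMMETRISATION `ε_K = Segre ∘ (s₆ ∘ ε, ε ∘ g)`: hyperplane class `7·ε^*g + g^*ε^*g`
  obtain ⟨gS, hgr, hgnz, hgσ⟩ := Motives.exists_segreHyperplaneClasses
  obtain ⟨M, hM⟩ : ∃ M : ℕ, M = ProjectiveSpace.segrePowDim mN 6 * mN + ProjectiveSpace.segrePowDim mN 6 + mN :=
    ⟨_, rfl⟩
  obtain ⟨εK, hεKdef⟩ : ∃ εK : 𝒳 ⟶ projectiveSpace M ℂ, εK = hM ▸ (CartesianMonoidalCategory.lift (𝟙 𝒳) g ≫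
      ((ε ≫ ProjectiveSpace.segrePow mN ℂ 6) ⊗ₘ ε) ≫ segreEmbedding (ProjectiveSpace.segrePowDim mN 6) mN ℂ) :=
    ⟨_, rfl⟩
  subst hM
  have hM1 : 1 ≤ ProjectiveSpace.segrePowDim mN 6 * mN + ProjectiveSpace.segrePowDim mN 6 + mN :=
    le_trans hmN (Nat.le_add_left _ _)
  have hεK : complexBetti.map εK 2 (gS _) =
      ((6 + 1 : ℕ) : ℂ) • complexBetti.map ε 2 (gS mN) + complexBetti.map g 2 (complexBetti.map ε 2 (gS mN)) := by
    rw [hεKdef]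
    change complexBetti.map (CartesianMonoidalCategory.lift (𝟙 𝒳) g ≫
      ((ε ≫ ProjectiveSpace.segrePow mN ℂ 6) ⊗ₘ ε) ≫ segreEmbedding (ProjectiveSpace.segrePowDim mN 6) mN ℂ) 2
        (gS _) = _
    rw [SegreHyperplaneClass.map_comp_apply', SegreHyperplaneClass.map_comp_apply', hgσ, map_add, map_add,
      SegreHyperplaneClass.map_tensorHom_map_fst, SegreHyperplaneClass.map_tensorHom_map_snd,
      SegreHyperplaneClass.map_lift_map_fst, SegreHyperplaneClass.map_lift_map_snd, complexBetti.map_id,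
      ModuleCat.id_apply, SegreHyperplaneClass.map_comp_apply',
      SegreHyperplaneClass.map_segrePow_of_additive gS hgσ mN 6, map_smul]
  -- the `K`-symmetrised morphism is a closed immersion on every fibre
  have hεKt : ∀ t : ComplexPoints S, IsClosedImmersion (fiberι f t ≫ εK).left := by
    intro t
    haveI := hε t
    haveI := SegreHyperplaneClass.isClosedImmersion_segrePow_left mN 6
    haveI : IsClosedImmersion (fiberι f t ≫ ε ≫ ProjectiveSpace.segrePow mN ℂ 6).left := by
      rw [← Category.assoc, Over.comp_left]
      infer_instance
    haveI := SegreHyperplaneClass.isSeparated_projectiveSpace_hom mN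
    haveI := SegreHyperplaneClass.isClosedImmersion_lift_id_left (X := fiberOver f t)
      (Y := projectiveSpace mN ℂ) (fiberι f t ≫ g ≫ ε)
    haveI := isClosedImmersion_tensorHom_left (X := fiberOver f t) (Y := projectiveSpace mN ℂ)
      (fiberι f t ≫ ε ≫ ProjectiveSpace.segrePow mN ℂ 6) (𝟙 (projectiveSpace mN ℂ))
    have heq : fiberι f t ≫ εK = (CartesianMonoidalCategory.lift (𝟙 _) (fiberι f t ≫ g ≫ ε) ≫
        ((fiberι f t ≫ ε ≫ ProjectiveSpace.segrePow mN ℂ 6) ⊗ₘ 𝟙 (projectiveSpace mN ℂ))) ≫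
        segreEmbedding (ProjectiveSpace.segrePowDim mN 6) mN ℂ := by
      rw [hεKdef]
      change fiberι f t ≫ CartesianMonoidalCategory.lift (𝟙 𝒳) g ≫
        ((ε ≫ ProjectiveSpace.segrePow mN ℂ 6) ⊗ₘ ε) ≫ segreEmbedding (ProjectiveSpace.segrePowDim mN 6) mN ℂ = _
      rw [← Category.assoc, CartesianMonoidalCategory.comp_lift, Category.comp_id, ← Category.assoc,
        CartesianMonoidalCategory.lift_map, CartesianMonoidalCategory.lift_map, Category.id_comp,
        Category.comp_id]
      simp only [Category.assoc]
    rw [heq, Over.comp_left, Over.comp_left]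
    infer_instance
  -- the induced projective embedding of the anchor `Y`, with its `K`-symmetric hyperplane class
  have hcl : IsClosedImmersion (e₀.hom ≫ fiberι f s₀ ≫ εK).left := by
    haveI : IsIso e₀.hom.left := (inferInstance : IsIso ((Over.forget _).mapIso e₀).hom)
    haveI := hεKt s₀
    rw [Over.comp_left]
    infer_instance
  let eY : ProjectiveEmbedding Y.X := ⟨_, e₀.hom ≫ fiberι f s₀ ≫ εK, hcl⟩
  have hΨ7 : Ψ ≫ Ψ = -(7 • 𝟙 Y) := by rw [hΨ, natCast_zsmul]
  have hKsym : complexBetti.map Ψ.hom.hom.hom 2 (complexBetti.map eY.ι 2 (gS _)) =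
      (7 : ℂ) • complexBetti.map eY.ι 2 (gS _) := by
    -- `h := e_Y^* g = 7·u + Ψ^*u` with `u = (e₀ ≫ ι_{s₀} ≫ ε)^* g_m`
    have hu : complexBetti.map e₀.hom 2 (complexBetti.map (fiberι f s₀) 2
        (complexBetti.map g 2 (complexBetti.map ε 2 (gS mN)))) =
        complexBetti.map Ψ.hom.hom.hom 2 (complexBetti.map (e₀.hom ≫ fiberι f s₀ ≫ ε) 2 (gS mN)) := by
      rw [← SegreHyperplaneClass.map_comp_apply', ← SegreHyperplaneClass.map_comp_apply',
        ← Category.assoc, he₀g, SegreHyperplaneClass.map_comp_apply', SegreHyperplaneClass.map_comp_apply',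
        SegreHyperplaneClass.map_comp_apply', SegreHyperplaneClass.map_comp_apply']
    have hh : complexBetti.map eY.ι 2 (gS _) =
        (7 : ℂ) • complexBetti.map (e₀.hom ≫ fiberι f s₀ ≫ ε) 2 (gS mN) +
          complexBetti.map Ψ.hom.hom.hom 2 (complexBetti.map (e₀.hom ≫ fiberι f s₀ ≫ ε) 2 (gS mN)) := by
      change complexBetti.map (e₀.hom ≫ fiberι f s₀ ≫ εK) 2 (gS _) = _
      rw [SegreHyperplaneClass.map_comp_apply', SegreHyperplaneClass.map_comp_apply', hεK, map_add, map_add,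
        map_smul, map_smul, hu, SegreHyperplaneClass.map_comp_apply', SegreHyperplaneClass.map_comp_apply']
      norm_num
    have hcomp : Ψ.hom.hom.hom ≫ Ψ.hom.hom.hom = (Ψ ≫ Ψ).hom.hom.hom := rfl
    rw [hh, map_add, map_smul, ← SegreHyperplaneClass.map_comp_apply' Ψ.hom.hom.hom Ψ.hom.hom.hom, hcomp, hΨ7,
      SegreHyperplaneClass.complexBetti_map_neg_nsmul_id_two, smul_add, smul_smul]
    norm_num
    abel
  -- the transported class on the anchor
  set x₀ : complexBetti Y.X (2 * 6) :=
    complexBetti.map e₀.hom (2 * 6) (complexBetti.map (fiberι f s₀) (2 * 6) W) with hx₀def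
  have hx₀rat : IsRationalClass x₀ := (hfibre s₀).1.map _
  have hx₀H : IsOfHodgeType (2 * 6) Y.X (2 * 6) 6 6 x₀ := by
    have h := (hfibre s₀).2.map_of_iso e₀
    exact h
  have hΨ' : Ψ ≫ Ψ = -((7 : ℤ) • 𝟙 Y) := by exact_mod_cast hΨ
  have htensor' : ∃ (A₁ : AbelianVariety ℂ) (f₁ : Y ⟶ A₁.prod A₁) (g₁ : A₁.prod A₁ ⟶ Y) (m : ℕ),
      A₁.dim = 6 ∧ 0 < m ∧ f₁ ≫ g₁ = m • 𝟙 Y ∧ Flat f₁.hom.hom.hom.left ∧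
      g₁ ≫ Ψ = AbelianVariety.prodLift (AbelianVariety.snd A₁ A₁ ≫ (-((7 : ℤ) • 𝟙 A₁)))
        (AbelianVariety.fst A₁ A₁) ≫ g₁ := by
    obtain ⟨A₁, f₁, g₁, m, hA₁, hm, hfg, hf, hg₁⟩ := htensor
    exact ⟨A₁, f₁, g₁, m, hA₁, hm, hfg, hf, by exact_mod_cast hg₁⟩
  -- STUB 2: the clean, charged, semiregular integral lci, produced INSIDE the fibre `𝒳_{s₀}` (copy `e₀`)
  obtain ⟨Z, i, θ, α, hci, hlci, hint, hcoh, hcohp, hsr, hθ, hα, hsupp⟩ :=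
    h₂ Y Ψ hY hΨ' htensor' eY (gS _) (hgr _) (hgnz _ hM1) hKsym x₀ hx₀ hx₀ne hx₀rat hx₀H (fiberOver f s₀) e₀
  -- the corrected global class
  set W' : complexBetti 𝒳 (2 * 6) := (α : ℂ) • W + complexBetti.map εK (2 * 6) θ with hW'def
  have hW's : ∀ s : ComplexPoints S, complexBetti.map (fiberι f s) (2 * 6) W' =
      (α : ℂ) • complexBetti.map (fiberι f s) (2 * 6) W + complexBetti.map (fiberι f s ≫ εK) (2 * 6) θ := by
    intro s
    rw [hW'def, map_add, map_smul, complexBetti.map_comp, CategoryTheory.comp_apply]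
  have halgθ : ∀ s : ComplexPoints S,
      complexBetti.map (fiberι f s ≫ εK) (2 * 6) θ ∈ algebraicClasses (fiberOver f s) 6 := fun s ↦
    map_projectiveSpace_mem_algebraicClasses (hfam.isSmoothProjective s) (fiberι f s ≫ εK) 6 θ
  have hfibre' : ∀ s : ComplexPoints S, IsRationalClass (complexBetti.map (fiberι f s) (2 * 6) W') ∧
      IsOfHodgeType (2 * 6) (fiberOver f s) (2 * 6) 6 6 (complexBetti.map (fiberι f s) (2 * 6) W') := by
    intro s
    rw [hW's s]
    refine ⟨((hfibre s).1.smul α).add (hθ.map _), ?_⟩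
    have hH1 : IsOfHodgeType (2 * 6) (fiberOver f s) (2 * 6) 6 6
        ((α : ℂ) • complexBetti.map (fiberι f s) (2 * 6) W) := ((hfibre s).2.smul (α : ℂ))
    have hH2 : IsOfHodgeType (2 * 6) (fiberOver f s) (2 * 6) 6 6
        (complexBetti.map (fiberι f s ≫ εK) (2 * 6) θ) :=
      isOfHodgeType_of_mem_algebraicClasses_of_isSmoothProjective (hfam.isSmoothProjective s) 6 (halgθ s)
    exact hH1.add (hfam.isSmoothProjective s) hH2
  -- on the anchor `W'` restricts, through `e₀`, to the class carried by `Z` …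
  have hxW' : complexBetti.map e₀.hom (2 * 6) (complexBetti.map (fiberι f s₀) (2 * 6) W') =
      (α : ℂ) • x₀ + complexBetti.map eY.ι (2 * 6) θ := by
    rw [hW's s₀, map_add, map_smul, ← hx₀def]
    congr 1
    change _ = complexBetti.map (e₀.hom ≫ fiberι f s₀ ≫ εK) (2 * 6) θ
    simp only [complexBetti.map_comp, CategoryTheory.comp_apply]
  -- … i.e. `W'|_{𝒳_{s₀}} = e₀^{-1 *}(α • x₀ + e_Y^*θ)` is supported on `Z`
  have hsupp' : complexBetti.map (fiberι f s₀) (2 * 6) W' ∈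
      classesSupportedOn (fiberOver f s₀) (Set.range i.base) (2 * 6) := by
    have hback : complexBetti.map e₀.inv (2 * 6)
        (complexBetti.map e₀.hom (2 * 6) (complexBetti.map (fiberι f s₀) (2 * 6) W')) =
          complexBetti.map (fiberι f s₀) (2 * 6) W' := by
      rw [← CategoryTheory.comp_apply, ← complexBetti.map_comp, Iso.inv_hom_id, complexBetti.map_id,
        CategoryTheory.id_apply]
    rw [← hback, hxW']
    exact hsupp
  -- STUBS 3a + 3b through the glue: Bloch lifts `Z`, Fulton's class, purity and rigidity spread algebraicity
  -- to a neighbourhood of `s₀`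
  obtain ⟨U, hUo, hs₀U, hU⟩ := semiregularSpread_of_blochLifts_of_fulton h₃a h₃b f (2 * 6) 6 hfam hemb hsm s₀ Z i
    hci hlci hint hcoh hcohp hsr W' (fun s ↦ (hfibre' s).2) hsupp'
  -- STUB 4 + Baire: algebraic at every fibre
  have hall := forall_mem_algebraicClasses_of_isOpen h₄ f hfam h𝒳qp hSqp hsm hirr W' hUo ⟨s₀, hs₀U⟩ hU
  -- at `s₁`: subtract the linear-section class and divide by `α`
  have h₁' : complexBetti.map (fiberι f s₁) (2 * 6) W ∈ algebraicClasses (fiberOver f s₁) 6 := by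
    have h := hall s₁
    rw [hW's s₁] at h
    have hsm' : (α : ℂ) • complexBetti.map (fiberι f s₁) (2 * 6) W ∈ algebraicClasses (fiberOver f s₁) 6 :=
      (Submodule.add_mem_iff_left _ (halgθ s₁)).1 h
    have hα' : (α : ℂ) ≠ 0 := by exact_mod_cast hα
    have h2 := Submodule.smul_mem _ ((α : ℂ)⁻¹) hsm'
    rwa [smul_smul, inv_mul_cancel₀ hα', one_smul] at h2
  -- return along `e : A ≅ 𝒳_{s₁}`
  have key := mem_algebraicClasses_map_of_iso (p := 6) (hfam.isSmoothProjective s₁)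
    (AbelianVariety.isSmoothProjective_holds (A := A)) e h₁'
  rw [hW₁, ← CategoryTheory.comp_apply, ← complexBetti.map_comp, Iso.hom_inv_id,
    complexBetti.map_id] at key
  exact key

/-- **`WeilTwelvefoldsSqrtMinus7` from the stubs** — the skeleton theorem (concludes the crux BY NAME;
depends on the stubs' `sorry`s and on nothing else). -/
theorem WeilTwelvefoldsSqrtMinus7_of_stubs :
    Summit.HodgeConjecture.HodgeConjecture.Theses.HeckePrymWeil.WeilTwelvefoldsSqrtMinus7 :=
  crux_of_stubs stub_deligneWeilFamily stub_semiregularCleanLci stub_blochLifts stub_fultonSpecialises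
    stub_algebraicityLocusClosed

/-! ### Certified cross-links (sorry-free) -/

/-- **The class Stub 2 must carry is ALGEBRAIC on the anchor** (so Stub 2 is Bloch's problem (7.5) —
semiregular integral lci representatives of a KNOWN algebraic class — not a hidden instance of the
crux): on a tensor-type `(Y, Ψ)` the whole strong Weil plane is algebraic (`owf_anchorAlgebraic`:
Künneth components of `Δ_{A₁}` across the isogeny pair, landed), and `e^*θ` is a linear-section class.
[cite: Deligne1982HodgeCycles, Lemma 4.5] [cite: VoisinHodgeII2003, §1.2.3 Cor. 1.24] -/
theorem stub2_class_mem_algebraicClasses (Y : AbelianVariety ℂ) (Ψ : Y ⟶ Y) (hY : Y.dim = 2 * 6)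
    (hΨ : Ψ ≫ Ψ = -((7 : ℤ) • 𝟙 Y))
    (htensor : ∃ (A₁ : AbelianVariety ℂ) (f₁ : Y ⟶ A₁.prod A₁) (g₁ : A₁.prod A₁ ⟶ Y) (m : ℕ),
        A₁.dim = 6 ∧ 0 < m ∧ f₁ ≫ g₁ = m • 𝟙 Y ∧ Flat f₁.hom.hom.hom.left ∧
        g₁ ≫ Ψ = AbelianVariety.prodLift (AbelianVariety.snd A₁ A₁ ≫ (-((7 : ℤ) • 𝟙 A₁)))
          (AbelianVariety.fst A₁ A₁) ≫ g₁)
    (e : ProjectiveEmbedding Y.X) (x₀ : complexBetti Y.X (2 * 6)) (hx₀ : x₀ ∈ weilClassesOf Y Ψ 6 7)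
    (θ : complexBetti (projectiveSpace e.n ℂ) (2 * 6)) (α : ℚ) :
    ((α : ℂ) • x₀ + complexBetti.map e.ι (2 * 6) θ) ∈ algebraicClasses Y.X 6 := by
  obtain ⟨A₁, f₁, g₁, m, hA₁, hm, hfg, hf, hg₁⟩ := htensor
  have hΨ' : Ψ ≫ Ψ = -(((7 : ℕ) : ℤ) • 𝟙 Y) := by exact_mod_cast hΨ
  have hg₁' : g₁ ≫ Ψ = AbelianVariety.prodLift (AbelianVariety.snd A₁ A₁ ≫ (-(((7 : ℕ) : ℤ) • 𝟙 A₁)))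
      (AbelianVariety.fst A₁ A₁) ≫ g₁ := by exact_mod_cast hg₁
  have halg : x₀ ∈ algebraicClasses Y.X 6 :=
    owf_anchorAlgebraic (p := 7) (by norm_num) (by norm_num) le_rfl A₁ f₁ g₁ m hA₁ hY hΨ' hm hfg hf hg₁' hx₀
  exact Submodule.add_mem _ (Submodule.smul_mem _ _ halg)
    (map_projectiveSpace_mem_algebraicClasses (AbelianVariety.isSmoothProjective_holds (A := Y)) e.ι 6 θ)

end Summit.HodgeConjecture.HodgeConjecture.Cruxes.WeilTwelvefoldsSqrtMinus7.SemiregularCleanLciAnchor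

end
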